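import Summits.QuantumAdvantage.AdviceFreeQNC0.WalkCoreBasics
import Summits.QuantumAdvantage.AdviceFreeQNC0.WindowLocalization
import HarnessLib

/-!
# Cell qa-qnc0 (rung F-Q1, route RingFrame, crux α): walk core — E2, THE LOSS IDENTITY
# (planner qa-qnc0-p1 Sketch10 §22.2, ask P9)

Statement VERBATIM from `Sketch10.lean` §22.2 (`LossIdentity`) and PROVED:

* `hdist_failCompl_eq` — for a fail pattern `F = ¬(P_{|·|})` of an even triple `P`, the Hamming
  distance from the walk row `WIN_y` to `F` is the LOSS COUNT `#{w : mixedWinU c' P y w = false}`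
  of the mixed completion `(P, y)`;
* **E2 `lossIdentity : LossIdentity`** — `distFail D (WIN_y) = min over even triples P of degree ≤ D
  of the loss count of (P, y)`: the two index sets coincide by E1 (`failCompl_iff_evenTriple`).

WHAT THIS IS NOT: nothing on α or the separation; E3/E6/W1–W3 are in the sibling `WalkCore*` files.
-/

noncomputable section

namespace Summit.QuantumAdvantage.AdviceFreeQNC0

open Finset
open Literature.Computability.MetaComplexity Literature.Computability.MetaComplexity.Smolensky

/-! ### Vocabulary (verbatim from `Sketch10` §22.2) -/

/-- **E2 — THE LOSS IDENTITY**: the cost `distFail D z` of a walk row `z = WIN_{y}` at charge `c'` is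
the LOSS COUNT OF THE BEST MIXED COMPLETION of `y` (verbatim from `Sketch10` §22.2). -/
def LossIdentity : Prop :=
  ∀ ℓ c' D : ℕ, ∀ y : Fin (ℓ + 1) → (Fin ℓ → Bool) → Bool,
    distFail D (ringWinU c' y) =
      sInf {k | ∃ P : ℕ → (Fin ℓ → Bool) → Bool, IsEvenTriple D P ∧
        (univ.filter fun w : Fin ℓ → Bool => mixedWinU c' P y w = false).card = k}

/-! ### Proof -/

/-- The distance from `WIN_y` to the complement pattern of a triple is the loss count of the mixed
completion. -/
theorem hdist_failCompl_eq {ℓ : ℕ} (c' : ℕ) (y : Fin (ℓ + 1) → (Fin ℓ → Bool) → Bool)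
    (P : ℕ → (Fin ℓ → Bool) → Bool) {F : (Fin ℓ → Bool) → Bool}
    (hF : ∀ w, F w = !(P (wt w % 3) w)) :
    hdist (ringWinU c' y) F =
      (univ.filter fun w : Fin ℓ → Bool => mixedWinU c' P y w = false).card := by
  unfold hdist mixedWinU
  refine congrArg Finset.card (Finset.filter_congr fun w _ => ?_)
  rw [hF w]
  cases P (wt w % 3) w <;> cases ringWinU c' y w <;> decide

/-- **E2 `LossIdentity`.** -/
theorem lossIdentity : LossIdentity := by
  intro ℓ c' D y
  unfold distFail
  congr 1
  ext k
  simp only [Set.mem_setOf_eq]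
  constructor
  · rintro ⟨F, hF, hk⟩
    obtain ⟨P, hP, hFP⟩ := (failCompl_iff_evenTriple ℓ D F).1 hF
    exact ⟨P, hP, by rw [← hdist_failCompl_eq c' y P hFP, hk]⟩
  · rintro ⟨P, hP, hk⟩
    refine ⟨fun w => !(P (wt w % 3) w), (failCompl_iff_evenTriple ℓ D _).2 ⟨P, hP, fun w => rfl⟩, ?_⟩
    rw [hdist_failCompl_eq c' y P (fun w => rfl), hk]

/-- Corollary: every even triple's loss count bounds the cost of the walk row from above. -/
theorem distFail_ringWinU_le {ℓ D : ℕ} (c' : ℕ) (y : Fin (ℓ + 1) → (Fin ℓ → Bool) → Bool)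
    (P : ℕ → (Fin ℓ → Bool) → Bool) (hP : IsEvenTriple D P) :
    distFail D (ringWinU c' y) ≤
      (univ.filter fun w : Fin ℓ → Bool => mixedWinU c' P y w = false).card := by
  rw [← hdist_failCompl_eq c' y P (F := fun w => !(P (wt w % 3) w)) (fun w => rfl)]
  exact distFail_le _ ((failCompl_iff_evenTriple ℓ D _).2 ⟨P, hP, fun w => rfl⟩)

/-- Corollary: the cost of the walk row is attained by some even triple. -/
theorem exists_evenTriple_loss_eq {ℓ D : ℕ} (c' : ℕ) (y : Fin (ℓ + 1) → (Fin ℓ → Bool) → Bool) :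
    ∃ P : ℕ → (Fin ℓ → Bool) → Bool, IsEvenTriple D P ∧
      (univ.filter fun w : Fin ℓ → Bool => mixedWinU c' P y w = false).card =
        distFail D (ringWinU c' y) := by
  obtain ⟨F, hF, hd⟩ := exists_distFail_eq D (ringWinU c' y)
  obtain ⟨P, hP, hFP⟩ := (failCompl_iff_evenTriple ℓ D F).1 hF
  exact ⟨P, hP, by rw [← hdist_failCompl_eq c' y P hFP, hd]⟩

end Summit.QuantumAdvantage.AdviceFreeQNC0

end
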